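import Mathlib
import HarnessLib
import Summits.HubbardSuperconductivity.HubbardSuperconductivity.Theorems.KLProgrammeKLRegimeTwoVolumeTowerBaseDefs
import Summits.HubbardSuperconductivity.HubbardSuperconductivity.Theorems.KLProgrammeKLRegimeTwoVolumeTowerEnd
import Summits.HubbardSuperconductivity.HubbardSuperconductivity.Theorems.KLProgrammeKLRegimeTwoVolumeDoubledRowsOne
import Summits.HubbardSuperconductivity.HubbardSuperconductivity.Theorems.KLProgrammeKLRegimeTwoVolumeGridOverlapPeriodisation

/-!
# Route `KLProgramme` — crux K3, VL child `KLRegimeVolumeLimitV17F2` (stmt-HubbardSuperconductivity-20440), blueprint v5 M5 / W4b: THE BASE TRANSFER — the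
# keyed defect of the step-`0` states from the keyed defect of the UV-stepped grid actions (seat hubbard-kl-k3c4-p1 g13; `--supports` 20440)

`klTowerState V … K 0 = klTowerD V … K 0 = map (toLin' (klBaseTransfer V … K)) (map (toLin' (klDoubleOne V N)) (klGridAction V … K))` (`…TowerBaseDefs`).
Exactly as at the END (`…TowerEnd`/`…TowerEndTransfer`), the keyed defect of the two volumes' step-`0` states at a `(D₀+r)`-deep pin splits into the FRAME SWAP
of the fine base transfer (`klBaseTransfer (bL) K″` against `klBaseTransfer (bL) K`, rows/columns `δ`) and the COMMON-FRAME keyed transfer through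
`klBaseTransfer · K` (block periodisation `klBaseTransfer_periodise`: the alive block periodises by `gridOverlap_periodise_leg` with the sampled fat family
`F_0[K]`, the plain source block by the same lemma with the trivial family), both fed by the TRIVIALLY DOUBLED grid actions, whose profiles and keyed defect
are `2^{n+1} ×` those of the grid actions (`…DoubledRowsOne`).

* `klSrcPlainBlock_mul_apply`, `klBaseTransfer_periodise`;
* **`tower_base_keyedDefect_le`** — `klKeyedDefect L b M … Kc Kf 0 (n+1) p w ≤ ε·2^{n+1}·((n+1)(cW+δ)ⁿ δ·NG(n+1) + tb(n))` from the base transfer data (scaled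
  rows/columns `cW`, block covariance, mismatch `δ`), the grid actions' `Λg`-weighted raw profiles `ε·NG`, and any majorant `ε·Eg` of the grid actions'
  keyed defect at the `D₀`-deep grid pins.

Proofs only; no definition.
-/

noncomputable section

namespace Summit.HubbardSuperconductivity.HubbardSuperconductivity.Theorems.TwoVolumeSource

set_option linter.dupNamespace false -- summit = problem name (single-conjunct summit), D-0017

open Finset Filter Topology Literature.MathematicalPhysics.QuantumLattice GrassmannAlgebra Literature.Probability.LatticeModels
  Literature.Probability.LatticeModels.BattleFederbush
open Summit.HubbardSuperconductivity.HubbardSuperconductivity.Theorems.TwoPointAssembly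
open Summit.HubbardSuperconductivity.HubbardSuperconductivity.Theorems.KLRegimeSplit
open Summit.HubbardSuperconductivity.HubbardSuperconductivity.Theorems.KLProgrammeLegKernels
open Summit.HubbardSuperconductivity.HubbardSuperconductivity.Theorems.EngineV8
open Summit.HubbardSuperconductivity.HubbardSuperconductivity.Theorems.TwoVolumeDefect

/-! ## §1 The plain source block and the periodisation of the base transfer -/

/-- Rows of `klSrcPlainBlock · S`: slot `0` ↦ `ε · (E(trivial) · S)` at the one-sector label, other slots ↦ `0`. [folklore] -/
theorem klSrcPlainBlock_mul_apply {V M : ℕ} [NeZero V] {Γ : Type*} [Fintype Γ] (β : ℝ) (S : Matrix (HubbardFieldIdx V M) Γ ℂ)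
    (Y : SpaceTimeIdx V M × SectorLeg (sectorCount 0)) (y : Γ) :
    (klSrcPlainBlock V M β * S) Y y =
      if (Y.2.1.1 : ℕ) = 0 then (((imagTimeWeight β M : ℝ) : ℂ)) * (sectorAnalysisMatrix V M β (trivialMultiplier V M) * S) (Y.1, (((0 : Fin 1), Y.2.1.2), Y.2.2)) y
      else 0 := by
  simp only [Matrix.mul_apply, klSrcPlainBlock, Matrix.of_apply]
  by_cases h0 : (Y.2.1.1 : ℕ) = 0
  · simp only [h0, if_true, mul_sum, mul_assoc]
  · simp only [h0, if_false, zero_mul, sum_const_zero]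

/-- **The base transfers of two volumes at a common frame are related by the doubled periodisation identity.** [folklore] -/
theorem klBaseTransfer_periodise {L b M : ℕ} [NeZero L] [NeZero (b * L)] [NeZero M] {β : ℝ} (hβ : β ≠ 0) (μ : ℝ) (K : TrigPolyC4v)
    (X' : SrcLabel (b * L) M 0) (Y : GridLeg (GridPoint L (klGridN M)) × Fin 2) :
    ∑ Y'' ∈ univ.filter (fun Y'' : GridLeg (GridPoint (b * L) (klGridN M)) × Fin 2 => (klGridBlockEquivD L b M Y'').2 = Y),
        klBaseTransfer (b * L) M β μ K X' Y'' = klBaseTransfer L M β μ K (klBlockEquivD L b M 0 X').2 Y := by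
  classical
  have hres : ∀ X' : SpaceTimeIdx (b * L) M × SectorLeg (sectorCount 0),
      (klBlockEquiv L b M (sectorCount 0) X').2 = ((X'.1.1, fun i => (((X'.1.2 i).val : ℕ) : ZMod L)), X'.2) := klBlockEquiv_snd L b M _
  refine doubleBlock_periodise (klGridBlockEquiv L b M) (klBlockEquiv L b M (sectorCount 0)) (klGridBlockEquivD L b M) (klGridBlockEquivD_apply L b M)
    (klBlockEquivD L b M 0) (klBlockEquivD_apply L b M 0)
    ((((imagTimeWeight β M : ℝ) : ℂ) • sectorAnalysisMatrix L M β (klAnisoFamily L M β μ K klE0 0)) * hubbardGridSub L M β (klGridN M))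
    (klSrcPlainBlock L M β * hubbardGridSub L M β (klGridN M))
    ((((imagTimeWeight β M : ℝ) : ℂ) • sectorAnalysisMatrix (b * L) M β (klAnisoFamily (b * L) M β μ K klE0 0)) * hubbardGridSub (b * L) M β (klGridN M))
    (klSrcPlainBlock (b * L) M β * hubbardGridSub (b * L) M β (klGridN M))
    (klBaseTransfer L M β μ K) (klBaseTransfer (b * L) M β μ K) (klBaseTransfer_apply β μ K) (klBaseTransfer_apply β μ K)
    (fun X' Y => ?_) (fun X' Y => ?_) X' Y
  · -- the alive block: `ε •` the sampled overlap `E(F_0[K])·S_N`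
    simp only [Matrix.smul_mul, Matrix.smul_apply, smul_eq_mul, ← mul_sum]
    rw [gridOverlap_periodise_leg (rfl : b * L = b * L) hβ
      (fun (ω' : Fin (sectorCount 0)) (i' : MatsubaraIdx M) (p : Fin 2 → ℝ) =>
        (((gnScaleCutoff 4 klE0 (-((0 : ℕ) : ℤ)) (Real.sqrt (matsubaraFreq β M i' ^ 2 + (-2 * ∑ j, Real.cos (p j) - μ - K.eval p) ^ 2)) *
            sectorWeightCirc 0 ω' (polarAngle (fun j => toIocMod Real.two_pi_pos (-Real.pi) (p j))) : ℝ) : ℂ)))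
      (klAnisoFamily L M β μ K klE0 0) (klAnisoFamily (b * L) M β μ K klE0 0)
      (fun ω i q => klAnisoFamily_eq_sampled β μ K klE0 0 ω i q) (fun ω i q => klAnisoFamily_eq_sampled β μ K klE0 0 ω i q)
      (klGridBlockEquiv L b M) (klGridBlockEquiv_snd L b M) X' Y, hres]
  · -- the plain source block: slot test, then the sampled trivial family
    simp only [klSrcPlainBlock_mul_apply, hres]
    by_cases h0 : (X'.2.1.1 : ℕ) = 0
    · simp only [h0, if_true, ← mul_sum]
      rw [gridOverlap_periodise_leg (rfl : b * L = b * L) hβ (fun (_ : Fin 1) (_ : MatsubaraIdx M) (_ : Fin 2 → ℝ) => (1 : ℂ))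
        (trivialMultiplier L M) (trivialMultiplier (b * L) M) (fun _ _ _ => rfl) (fun _ _ _ => rfl)
        (klGridBlockEquiv L b M) (klGridBlockEquiv_snd L b M) (X'.1, (((0 : Fin 1), X'.2.1.2), X'.2.2)) Y]
    · simp only [h0, if_false, sum_const_zero]

/-! ## §2 The keyed defect of the step-`0` states -/

set_option maxHeartbeats 400000 in -- doubling, frame swap and the nine-data transfer in one declaration
/-- **THE BASE TRANSFER** (see the module docstring). [folklore: the transfer half of the per-scale step at the base; cite: BenfattoGiulianiMastropietro2006, §2.7 (2.70)-(2.71), §3] -/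
theorem tower_base_keyedDefect_le {L b M : ℕ} [NeZero L] [NeZero (b * L)] [NeZero M] (β U μ : ℝ) (hβ : β ≠ 0) (Kc Kf : TrigPolyC4v)
    {ε : ℝ} (hε : 0 < ε)
    -- the base transfer of the fine volume at the COARSE frame: `Λ_T`-scaled rows/columns, block covariance
    {ΛT cW : ℝ} (hΛT : 0 ≤ ΛT) (hcW : 0 ≤ cW)
    (hrowT : ∀ x : SrcLabel (b * L) M 0, ∑ y, ‖klBaseTransfer (b * L) M β μ Kc x y‖ * (1 + ΛT * (Torus.tnorm (x.1.1.2 - y.1.1.1.2) : ℝ)) ≤ cW)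
    (hcolT : ∀ y : GridLeg (GridPoint (b * L) (klGridN M)) × Fin 2, ∑ x, ‖klBaseTransfer (b * L) M β μ Kc x y‖ * (1 + ΛT * (Torus.tnorm (x.1.1.2 - y.1.1.1.2) : ℝ)) ≤ cW)
    (hcovT : ∀ (δ' β' β₁ : Fin 2 → Fin b) (xbar : SrcLabel L M 0) (y : GridLeg (GridPoint L (klGridN M)) × Fin 2),
      ‖klBaseTransfer (b * L) M β μ Kc ((klBlockEquivD L b M 0).symm (β' + δ', xbar)) ((klGridBlockEquivD L b M).symm (β₁ + δ', y))‖ =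
        ‖klBaseTransfer (b * L) M β μ Kc ((klBlockEquivD L b M 0).symm (β', xbar)) ((klGridBlockEquivD L b M).symm (β₁, y))‖)
    -- the mismatch of the fine base transfer between the two frames
    {δ : ℝ} (hδ0 : 0 ≤ δ)
    (htrow : ∀ x, ∑ y, ‖klBaseTransfer (b * L) M β μ Kf x y - klBaseTransfer (b * L) M β μ Kc x y‖ ≤ δ)
    (htcol : ∀ y, ∑ x, ‖klBaseTransfer (b * L) M β μ Kf x y - klBaseTransfer (b * L) M β μ Kc x y‖ ≤ δ)
    -- the grid actions' `Λg`-weighted raw profiles (own frames), normalised `ε·NG`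
    {Λg : ℝ} (hΛg : 0 ≤ Λg) (NG : ℕ → ℝ) (hNG0 : ∀ k, 0 ≤ NG k)
    (hNc : ∀ (k : ℕ) (p : Fin k) (y : GridLeg (GridPoint L (klGridN M))),
      ∑ Y ∈ univ.filter (fun Y : Fin k → GridLeg (GridPoint L (klGridN M)) => Y p = y),
        ‖kernel ℂ (klGridAction L M β U μ Kc) k Y‖ *
          (1 + labelDiam (fun Y₁ Y₂ : GridLeg (GridPoint L (klGridN M)) => Λg * (Torus.tnorm (Y₁.1.1.2 - Y₂.1.1.2) : ℝ)) (univ.image Y)) ≤ ε * NG k)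
    (hNf : ∀ (k : ℕ) (p : Fin k) (y : GridLeg (GridPoint (b * L) (klGridN M))),
      ∑ Y ∈ univ.filter (fun Y : Fin k → GridLeg (GridPoint (b * L) (klGridN M)) => Y p = y),
        ‖kernel ℂ (klGridAction (b * L) M β U μ Kf) k Y‖ *
          (1 + labelDiam (fun Y₁ Y₂ : GridLeg (GridPoint (b * L) (klGridN M)) => Λg * (Torus.tnorm (Y₁.1.1.2 - Y₂.1.1.2) : ℝ)) (univ.image Y)) ≤ ε * NG k)
    -- the grid actions' keyed defect at the `D₀`-deep grid pins
    (D₀ r : ℕ) (hD₀ : 2 * r ≤ D₀) (Eg : ℕ → ℝ) (hEg0 : ∀ k, 0 ≤ Eg k)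
    (hEg : ∀ (k : ℕ) (p' : Fin k) (y' : GridLeg (GridPoint (b * L) (klGridN M))), (∀ i, D₀ ≤ (y'.1.1.2 i).val % L ∧ (y'.1.1.2 i).val % L + D₀ < L) →
      ∑ Y' ∈ univ.filter (fun Y' : Fin k → GridLeg (GridPoint (b * L) (klGridN M)) => Y' p' = y'),
        ‖kernel ℂ (klGridAction (b * L) M β U μ Kf) k Y' -
          (if ∀ i, (klGridBlockEquiv L b M (Y' i)).1 = (klGridBlockEquiv L b M (Y' p')).1 then
            kernel ℂ (klGridAction L M β U μ Kc) k (fun i => (klGridBlockEquiv L b M (Y' i)).2) else 0)‖ ≤ ε * Eg k)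
    (n : ℕ) (p : Fin (n + 1)) (w : SrcLabel (b * L) M 0) (hw : ∀ i, D₀ + r ≤ (w.1.1.2 i).val % L ∧ (w.1.1.2 i).val % L + (D₀ + r) < L) :
    klKeyedDefect L b M β U μ Kc Kf 0 (n + 1) p w ≤
      ε * 2 ^ (n + 1) * (((n : ℝ) + 1) * (cW + δ) ^ n * δ * NG (n + 1) +
        (cW ^ n * (cW * Eg (n + 1) + cW / (1 + ΛT * ((r : ℝ) + 1)) * (NG (n + 1) + NG (n + 1))) +
          (2 * cW ^ n * (cW / (1 + ΛT * ((r : ℝ) + 1))) * NG (n + 1) +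
            (n : ℝ) * cW ^ n * (5 * (cW / (1 + ΛT * ((r : ℝ) + 1))) * NG (n + 1) + 2 * cW * ((1 + Λg * ((r : ℝ) + 1))⁻¹ * NG (n + 1)))))) := by
  classical
  haveI : NeZero b := ⟨fun h => NeZero.ne (b * L) (by rw [h, zero_mul])⟩
  -- §0 the states of step `0` are the base transfers of the doubled grid actions
  rw [klKeyedDefect_eq]
  show ∑ X ∈ univ.filter (fun X : Fin (n + 1) → SrcLabel (b * L) M 0 => X p = w),
      ‖kernel ℂ (klTowerD (b * L) M β U μ Kf 0) (n + 1) X -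
        (if ∀ i, (klBlockEquivD L b M 0 (X i)).1 = (klBlockEquivD L b M 0 (X p)).1 then
          kernel ℂ (klTowerD L M β U μ Kc 0) (n + 1) (fun i => (klBlockEquivD L b M 0 (X i)).2) else 0)‖ ≤ _
  rw [klTowerD_zero_eq_map_klBaseTransfer hβ U μ Kf, klTowerD_zero_eq_map_klBaseTransfer hβ U μ Kc]
  set ed := klBlockEquivD L b M 0 with hed_def
  set eg := klGridBlockEquiv L b M with heg_def
  set edg := klGridBlockEquivD L b M with hedg_def
  set T₁ := klBaseTransfer (b * L) M β μ Kf with hT₁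
  set Tpf := klBaseTransfer (b * L) M β μ Kc with hTpf_def
  set Tpc := klBaseTransfer L M β μ Kc with hTpc_def
  set Yf := ExteriorAlgebra.map (Matrix.toLin' (klDoubleOne (b * L) (klGridN M))) (klGridAction (b * L) M β U μ Kf) with hYf
  set Yc := ExteriorAlgebra.map (Matrix.toLin' (klDoubleOne L (klGridN M))) (klGridAction L M β U μ Kc) with hYc
  have h2n : (0 : ℝ) ≤ 2 ^ (n + 1) := by positivity
  -- §1 the doubled profiles: unweighted (both volumes), weighted (coarse), keyed defect
  have hNf0 : ∀ y : GridLeg (GridPoint (b * L) (klGridN M)),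
      ∑ Y ∈ univ.filter (fun Y : Fin (n + 1) → GridLeg (GridPoint (b * L) (klGridN M)) => Y p = y), ‖kernel ℂ (klGridAction (b * L) M β U μ Kf) (n + 1) Y‖ ≤ ε * NG (n + 1) :=
    fun y => sum_filter_norm_kernel_le_of_weighted _ (n + 1) p y _
      (fun Y => by have := labelDiam_nonneg (fun Y₁ Y₂ : GridLeg (GridPoint (b * L) (klGridN M)) => Λg * (Torus.tnorm (Y₁.1.1.2 - Y₂.1.1.2) : ℝ)) (univ.image Y); linarith)
      (hNf (n + 1) p y)
  have hNc0 : ∀ y : GridLeg (GridPoint L (klGridN M)),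
      ∑ Y ∈ univ.filter (fun Y : Fin (n + 1) → GridLeg (GridPoint L (klGridN M)) => Y p = y), ‖kernel ℂ (klGridAction L M β U μ Kc) (n + 1) Y‖ ≤ ε * NG (n + 1) :=
    fun y => sum_filter_norm_kernel_le_of_weighted _ (n + 1) p y _
      (fun Y => by have := labelDiam_nonneg (fun Y₁ Y₂ : GridLeg (GridPoint L (klGridN M)) => Λg * (Torus.tnorm (Y₁.1.1.2 - Y₂.1.1.2) : ℝ)) (univ.image Y); linarith)
      (hNc (n + 1) p y)
  have hNf1 : ∀ y : GridLeg (GridPoint (b * L) (klGridN M)) × Fin 2,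
      ∑ Y ∈ univ.filter (fun Y : Fin (n + 1) → GridLeg (GridPoint (b * L) (klGridN M)) × Fin 2 => Y p = y), ‖kernel ℂ Yf (n + 1) Y‖ ≤ 2 ^ (n + 1) * (ε * NG (n + 1)) := by
    intro y
    have h := sum_filter_norm_kernel_doubleOne_mul_le (klDoubleOne (b * L) (klGridN M)) (klDoubleOne_apply (klGridN M)) (klGridAction (b * L) M β U μ Kf) (n + 1) p y
      (fun _ => (1 : ℝ)) (fun _ => zero_le_one) (N := ε * NG (n + 1)) (by simpa only [mul_one] using hNf0 y.1)
    simpa only [mul_one] using h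
  have hNc1 : ∀ y : GridLeg (GridPoint L (klGridN M)) × Fin 2,
      ∑ Y ∈ univ.filter (fun Y : Fin (n + 1) → GridLeg (GridPoint L (klGridN M)) × Fin 2 => Y p = y), ‖kernel ℂ Yc (n + 1) Y‖ ≤ 2 ^ (n + 1) * (ε * NG (n + 1)) := by
    intro y
    have h := sum_filter_norm_kernel_doubleOne_mul_le (klDoubleOne L (klGridN M)) (klDoubleOne_apply (klGridN M)) (klGridAction L M β U μ Kc) (n + 1) p y
      (fun _ => (1 : ℝ)) (fun _ => zero_le_one) (N := ε * NG (n + 1)) (by simpa only [mul_one] using hNc0 y.1)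
    simpa only [mul_one] using h
  have hwt_eq : ∀ Y : Fin (n + 1) → GridLeg (GridPoint L (klGridN M)) × Fin 2,
      labelDiam (fun Y₁ Y₂ : GridLeg (GridPoint L (klGridN M)) × Fin 2 => Λg * (Torus.tnorm (Y₁.1.1.1.2 - Y₂.1.1.1.2) : ℝ)) (univ.image Y) =
        labelDiam (fun Y₁ Y₂ : GridLeg (GridPoint L (klGridN M)) => Λg * (Torus.tnorm (Y₁.1.1.2 - Y₂.1.1.2) : ℝ)) (univ.image (fun i => (Y i).1)) := by
    intro Y
    have h := labelDiam_comap_image (fun Y₁ Y₂ : GridLeg (GridPoint L (klGridN M)) => Λg * (Torus.tnorm (Y₁.1.1.2 - Y₂.1.1.2) : ℝ)) Prod.fst (univ.image Y)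
    rw [Finset.image_image] at h
    exact h
  have hNcw : ∀ y : GridLeg (GridPoint L (klGridN M)) × Fin 2,
      ∑ Y ∈ univ.filter (fun Y : Fin (n + 1) → GridLeg (GridPoint L (klGridN M)) × Fin 2 => Y p = y), ‖kernel ℂ Yc (n + 1) Y‖ *
        (1 + labelDiam (fun Y₁ Y₂ : GridLeg (GridPoint L (klGridN M)) × Fin 2 => Λg * (Torus.tnorm (Y₁.1.1.1.2 - Y₂.1.1.1.2) : ℝ)) (univ.image Y)) ≤
          2 ^ (n + 1) * (ε * NG (n + 1)) := by
    intro y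
    have h := sum_filter_norm_kernel_doubleOne_mul_le (klDoubleOne L (klGridN M)) (klDoubleOne_apply (klGridN M)) (klGridAction L M β U μ Kc) (n + 1) p y
      (fun Y => 1 + labelDiam (fun Y₁ Y₂ : GridLeg (GridPoint L (klGridN M)) => Λg * (Torus.tnorm (Y₁.1.1.2 - Y₂.1.1.2) : ℝ)) (univ.image Y))
      (fun Y => by have := labelDiam_nonneg (fun Y₁ Y₂ : GridLeg (GridPoint L (klGridN M)) => Λg * (Torus.tnorm (Y₁.1.1.2 - Y₂.1.1.2) : ℝ)) (univ.image Y); linarith)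
      (hNc (n + 1) p y.1)
    refine le_trans (le_of_eq (sum_congr rfl fun Y _ => by rw [hwt_eq Y])) h
  -- §2 the frame swap on the fine volume
  have hwt : ∀ (x : SrcLabel (b * L) M 0) (y : GridLeg (GridPoint (b * L) (klGridN M)) × Fin 2), ‖Tpf x y‖ ≤ ‖Tpf x y‖ * (1 + ΛT * (Torus.tnorm (x.1.1.2 - y.1.1.1.2) : ℝ)) :=
    fun x y => le_mul_of_one_le_right (norm_nonneg _) (le_add_of_nonneg_right (by positivity))
  have hswap := sum_pinned_norm_kernel_map_sub_map_le T₁ Tpf (fun x y => ‖Tpf x y‖ + ‖T₁ x y - Tpf x y‖) Yf p w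
    (add_nonneg hcW hδ0) hδ0 (mul_nonneg h2n (mul_nonneg hε.le (hNG0 (n + 1))))
    (fun x y => by have h := norm_add_le (Tpf x y) (T₁ x y - Tpf x y); rwa [add_sub_cancel] at h)
    (fun x y => le_add_of_nonneg_right (norm_nonneg _))
    (fun y => by rw [sum_add_distrib]; exact add_le_add ((sum_le_sum fun x _ => hwt x y).trans (hcolT y)) (htcol y))
    (by rw [sum_add_distrib]; exact add_le_add ((sum_le_sum fun y _ => hwt w y).trans (hrowT w)) (htrow w))
    htcol (htrow w) hNf1
  -- §3 the nine transfer data (`aT := cW`, `τT := cW/(1+Λ_T(r+1))`), regions `R := D₀ + r`, `RN := r`, `RZ := 2r`, `RF := r`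
  have hed1 : ∀ (x : SrcLabel (b * L) M 0) i, ((ed x).1 i : ℕ) = (x.1.1.2 i).val / L := fun x i => by
    obtain ⟨x, s⟩ := x; rw [hed_def, klBlockEquivD_apply]; exact klBlockEquiv_val L b M _ x i
  have hedg1 : ∀ (y' : GridLeg (GridPoint (b * L) (klGridN M)) × Fin 2) i, ((edg y').1 i : ℕ) = (y'.1.1.1.2 i).val / L := fun y' i => by
    obtain ⟨y, s⟩ := y'; rw [hedg_def, klGridBlockEquivD_apply]; exact klGridBlockEquiv_val L b M y i
  have hed2s : ∀ x : SrcLabel (b * L) M 0, (fun Y : SrcLabel L M 0 => Y.1.1.2) (ed x).2 = fun i => ((((x.1.1.2 i).val : ℕ)) : ZMod L) := fun x => by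
    obtain ⟨x, s⟩ := x; rw [hed_def, klBlockEquivD_apply]; dsimp only; rw [klBlockEquiv_snd]
  have hedg2s : ∀ y' : GridLeg (GridPoint (b * L) (klGridN M)) × Fin 2,
      (fun Y : GridLeg (GridPoint L (klGridN M)) × Fin 2 => Y.1.1.1.2) (edg y').2 = fun i => ((((y'.1.1.1.2 i).val : ℕ)) : ZMod L) := fun y' => by
    obtain ⟨y, s⟩ := y'; rw [hedg_def, klGridBlockEquivD_apply]; dsimp only; rw [klGridBlockEquiv_snd]
  have hτT : 0 ≤ cW / (1 + ΛT * ((r : ℝ) + 1)) := by positivity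
  have hTcol := transfer_col_le (fun x : SrcLabel (b * L) M 0 => x.1.1.2) (fun y' : GridLeg (GridPoint (b * L) (klGridN M)) × Fin 2 => y'.1.1.1.2) Tpf hΛT hcolT
  have hTwin := transfer_win_le (fun x : SrcLabel (b * L) M 0 => x.1.1.2) (fun y' : GridLeg (GridPoint (b * L) (klGridN M)) × Fin 2 => y'.1.1.1.2) Tpf hΛT hcolT
    ed edg hcovT
  have hTρ := transfer_rho_le (fun x : SrcLabel (b * L) M 0 => x.1.1.2) (fun y' : GridLeg (GridPoint (b * L) (klGridN M)) × Fin 2 => y'.1.1.1.2) Tpf hΛT hrowT ed edg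
  have hTrowF := transfer_rowF_le (fun x : SrcLabel (b * L) M 0 => x.1.1.2) (fun y' : GridLeg (GridPoint (b * L) (klGridN M)) × Fin 2 => y'.1.1.1.2) Tpf hΛT hrowT r
  have hTτF := transfer_tauF_le (fun x : SrcLabel (b * L) M 0 => x.1.1.2) (fun y' : GridLeg (GridPoint (b * L) (klGridN M)) × Fin 2 => y'.1.1.1.2) Tpf hΛT hrowT hcW
    (le_refl r)
  have hTτ2 := transfer_tau2_le (fun x : SrcLabel (b * L) M 0 => x.1.1.2) (fun y' : GridLeg (GridPoint (b * L) (klGridN M)) × Fin 2 => y'.1.1.1.2) Tpf hΛT hrowT hcW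
    (rfl : b * L = b * L) ed edg hed1 hedg1 (Nat.le_add_left r D₀) w hw
  have hTτ3 := transfer_tau3_le (fun x : SrcLabel (b * L) M 0 => x.1.1.2) (fun y' : GridLeg (GridPoint (b * L) (klGridN M)) × Fin 2 => y'.1.1.1.2) Tpf hΛT hrowT hcW
    (rfl : b * L = b * L) ed edg (fun Y : SrcLabel L M 0 => Y.1.1.2) (fun Y : GridLeg (GridPoint L (klGridN M)) × Fin 2 => Y.1.1.1.2) hed2s hedg2s (le_refl r) w
  have hTτ1 := transfer_tau1_le (fun x : SrcLabel (b * L) M 0 => x.1.1.2) (fun y' : GridLeg (GridPoint (b * L) (klGridN M)) × Fin 2 => y'.1.1.1.2) Tpf hΛT hcolT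
    (rfl : b * L = b * L) ed edg hed1 hedg1 (fun Y : SrcLabel L M 0 => Y.1.1.2) (fun Y : GridLeg (GridPoint L (klGridN M)) × Fin 2 => Y.1.1.1.2) hed2s hedg2s
    (RZ := 2 * r) (by omega : r + 2 * r ≤ D₀ + r) w hw
  have hTτ4 := transfer_tau4_le (fun x : SrcLabel (b * L) M 0 => x.1.1.2) (fun y' : GridLeg (GridPoint (b * L) (klGridN M)) × Fin 2 => y'.1.1.1.2) Tpf hΛT hcolT
    (rfl : b * L = b * L) ed edg hed1 hedg1 (fun Y : SrcLabel L M 0 => Y.1.1.2) (fun Y : GridLeg (GridPoint L (klGridN M)) × Fin 2 => Y.1.1.1.2) hed2s hedg2s hcovT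
    (RZ := 2 * r) (by omega : r + 2 * r ≤ D₀ + r) w hw
  -- §4 block embeddings, periodisation, the transfer triangle, the far profile, the two-volume data in glued form
  set Fe : (Fin 2 → Fin b) → (SrcLabel L M 0 → ℂ) →ₗ[ℂ] (SrcLabel (b * L) M 0 → ℂ) := fun β' =>
    LinearMap.pi (fun X' : SrcLabel (b * L) M 0 => if (ed X').1 = β' then (LinearMap.proj (ed X').2 : (SrcLabel L M 0 → ℂ) →ₗ[ℂ] ℂ) else 0) with hFe_def
  have hFe : ∀ β' v X', Fe β' v X' = if (ed X').1 = β' then v (ed X').2 else 0 := fun β' v X' => blockEmb_pi_apply ℂ ed β' v X'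
  set Fe₁ : (Fin 2 → Fin b) → (GridLeg (GridPoint L (klGridN M)) × Fin 2 → ℂ) →ₗ[ℂ] (GridLeg (GridPoint (b * L) (klGridN M)) × Fin 2 → ℂ) := fun β' =>
    LinearMap.pi (fun X' : GridLeg (GridPoint (b * L) (klGridN M)) × Fin 2 => if (edg X').1 = β' then
      (LinearMap.proj (edg X').2 : (GridLeg (GridPoint L (klGridN M)) × Fin 2 → ℂ) →ₗ[ℂ] ℂ) else 0) with hFe₁_def
  have hFe₁ : ∀ β' v X', Fe₁ β' v X' = if (edg X').1 = β' then v (edg X').2 else 0 := fun β' v X' => blockEmb_pi_apply ℂ edg β' v X'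
  have hPT : ∀ (X' : SrcLabel (b * L) M 0) (Y : GridLeg (GridPoint L (klGridN M)) × Fin 2),
      ∑ Y'' ∈ univ.filter (fun Y'' : GridLeg (GridPoint (b * L) (klGridN M)) × Fin 2 => (edg Y'').2 = Y), Tpf X' Y'' = Tpc (ed X').2 Y :=
    fun X' Y => klBaseTransfer_periodise hβ μ Kc X' Y
  have hZT : ∀ y y' : GridLeg (GridPoint L (klGridN M)) × Fin 2, Torus.tnorm ((ed w).2.1.1.2 - y.1.1.1.2) ≤ r → 2 * r < Torus.tnorm ((ed w).2.1.1.2 - y'.1.1.1.2) →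
      r < Torus.tnorm (y.1.1.1.2 - y'.1.1.1.2) := by
    intro y y' hy hy'
    have htri := Torus.tnorm_add_le ((ed w).2.1.1.2 - y.1.1.1.2) (y.1.1.1.2 - y'.1.1.1.2)
    rw [sub_add_sub_cancel] at htri; omega
  have hNfarj : ∀ (y : GridLeg (GridPoint L (klGridN M)) × Fin 2) (i : Fin (n + 1)),
      ∑ Y ∈ univ.filter (fun Y : Fin (n + 1) → GridLeg (GridPoint L (klGridN M)) × Fin 2 => Y p = y ∧ r < Torus.tnorm ((Y p).1.1.1.2 - (Y i).1.1.1.2)), ‖kernel ℂ Yc (n + 1) Y‖ ≤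
        (1 + Λg * ((r : ℝ) + 1))⁻¹ * (2 ^ (n + 1) * (ε * NG (n + 1))) :=
    fun y i => sum_far_norm_kernel_le_of_scaledWeighted (fun Y : GridLeg (GridPoint L (klGridN M)) × Fin 2 => Y.1.1.1.2) Yc hΛg (n + 1) p y i r (hNcw y)
  have hsub₁ : ∀ (q : Fin (n + 1)) (Y' : Fin (n + 1) → GridLeg (GridPoint (b * L) (klGridN M)) × Fin 2),
      kernel ℂ (∑ β', ExteriorAlgebra.map (Fe₁ β') Yc) (n + 1) Y' = if ∀ i, (edg (Y' i)).1 = (edg (Y' q)).1 then kernel ℂ Yc (n + 1) (fun i => (edg (Y' i)).2) else 0 :=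
    fun q Y' => kernel_copies_sum edg Fe₁ hFe₁ _ q Y'
  have hEj' : ∀ y' : GridLeg (GridPoint (b * L) (klGridN M)) × Fin 2, Torus.tnorm (w.1.1.2 - y'.1.1.1.2) ≤ r →
      ∑ Y' ∈ univ.filter (fun Y' : Fin (n + 1) → GridLeg (GridPoint (b * L) (klGridN M)) × Fin 2 => Y' p = y'),
        ‖kernel ℂ (Yf - ∑ β', ExteriorAlgebra.map (Fe₁ β') Yc) (n + 1) Y'‖ ≤ 2 ^ (n + 1) * (ε * Eg (n + 1)) := by
    intro y' hy'
    simp only [kernel_sub', hsub₁ p]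
    have hdeep : ∀ i, D₀ ≤ (y'.1.1.1.2 i).val % L ∧ (y'.1.1.1.2 i).val % L + D₀ < L :=
      deepRes_of_tnorm_le (b := b) (m := L) (Mf := b * L) rfl hw hy'
    exact sum_filter_norm_keyedGlued_doubleOne_le eg edg (klGridBlockEquivD_apply L b M) (klDoubleOne L (klGridN M)) (klDoubleOne_apply (klGridN M))
      (klDoubleOne (b * L) (klGridN M)) (klDoubleOne_apply (klGridN M)) (klGridAction L M β U μ Kc) (klGridAction (b * L) M β U μ Kf) (n + 1) p y'
      (hEg (n + 1) p y'.1 hdeep)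
  have hNDj' : ∀ y' : GridLeg (GridPoint (b * L) (klGridN M)) × Fin 2,
      ∑ Y' ∈ univ.filter (fun Y' : Fin (n + 1) → GridLeg (GridPoint (b * L) (klGridN M)) × Fin 2 => Y' p = y'),
        ‖kernel ℂ (Yf - ∑ β', ExteriorAlgebra.map (Fe₁ β') Yc) (n + 1) Y'‖ ≤ 2 ^ (n + 1) * (ε * NG (n + 1)) + 2 ^ (n + 1) * (ε * NG (n + 1)) := by
    intro y'
    simp only [kernel_sub', hsub₁ p]
    exact sum_filter_norm_keyedGlued_le_of_profiles edg Yf Yc p y' (hNf1 y') (hNc1 _)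
  -- §5 the gluing bracket
  have hsub : ∀ X : Fin (n + 1) → SrcLabel (b * L) M 0,
      kernel ℂ (∑ β', ExteriorAlgebra.map (Fe β') (ExteriorAlgebra.map (Matrix.toLin' Tpc) Yc)) (n + 1) X =
        if ∀ i, (ed (X i)).1 = (ed (X p)).1 then kernel ℂ (ExteriorAlgebra.map (Matrix.toLin' Tpc) Yc) (n + 1) (fun i => (ed (X i)).2) else 0 :=
    fun X => kernel_copies_sum ed Fe hFe _ p X
  have htrans := sum_norm_kernel_map_sub_glue_map_le_of_defect edg ed Tpc Tpf hPT Fe₁ hFe₁ Fe hFe Yf Yc p w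
    (fun y : GridLeg (GridPoint L (klGridN M)) × Fin 2 => 2 * r < Torus.tnorm ((ed w).2.1.1.2 - y.1.1.1.2))
    (fun y : GridLeg (GridPoint L (klGridN M)) × Fin 2 => Torus.tnorm ((ed w).2.1.1.2 - y.1.1.1.2) ≤ r)
    (fun y y' : GridLeg (GridPoint L (klGridN M)) × Fin 2 => r < Torus.tnorm (y.1.1.1.2 - y'.1.1.1.2)) hZT
    (fun y' : GridLeg (GridPoint (b * L) (klGridN M)) × Fin 2 => Torus.tnorm (w.1.1.2 - y'.1.1.1.2) ≤ r)
    hcW hτT (mul_nonneg h2n (mul_nonneg hε.le (hNG0 _))) (mul_nonneg (inv_nonneg.2 (by positivity)) (mul_nonneg h2n (mul_nonneg hε.le (hNG0 _))))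
    (mul_nonneg h2n (mul_nonneg hε.le (hEg0 _))) (add_nonneg (mul_nonneg h2n (mul_nonneg hε.le (hNG0 _))) (mul_nonneg h2n (mul_nonneg hε.le (hNG0 _))))
    hTcol hTwin (hTρ w) (hTrowF w) (hTτF w) (fun y hy => hTτ1 y hy) hTτ2 hTτ3 (fun y hy => hTτ4 y hy) hNc1 hNfarj hEj' hNDj'
  -- §6 splice: fine frame swap + keyed transfer (read in keyed form)
  simp only [hsub] at htrans
  refine (sum_norm_keyedGlued_le_of_fine_response ed _ _ _ p _ hswap htrans).trans (le_of_eq ?_)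
  ring

end Summit.HubbardSuperconductivity.HubbardSuperconductivity.Theorems.TwoVolumeSource

end
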